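import Mathlib
import Summits.NavierStokesRegularity.NavierStokesRegularity.Theorems.EulerZoomLiouvillePowerGaugeEulerLiouvilleAnchoredBudgetFloorPath
import Literature.Analysis.FluidPDE.TrajectoryJacobianLiouville
import Literature.Analysis.FluidPDE.SpaceTimeCalculus
import Literature.Analysis.ODE.EvolutionMapHomeomorph
import Literature.Analysis.ODE.EvolutionMapSmooth
import HarnessLib

/-!
# Crux `EulerZoomLiouville.PowerGaugeEulerLiouville` (stmt-NavierStokesRegularity-19832), line `anchored-budget` REV3, stub C1 — part 2:
# THE CUTOFF-FIELD FLOW: a global flow that is the particle flow inside a ball, and has Jacobian one on the labels that stay there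

Route №10 `EulerZoomLiouville` (NavierStokesRegularity), crux E.  Line `anchored-budget` (ideator ns-idea-11 g4;
`Cruxes/PowerGaugeEulerLiouville/Lines/anchored_budget.lean`, REV3 = text of record, critic V37b), stub C1 `stub_anchoredFloorTransport`
(seat ns-sfl-p1 g4).  REV3 drops the flow-owning clause of `IsAnchorablePast`: a classical Euler flow `u` on a time set `S` need not own
a global particle flow.  The line's device (card, C1 docstring): run the tree's GLOBAL flow kit (`Literature.Analysis.ODE.evolutionMap`)
on the CUTOFF FIELD `ũ(t,x) = ψ(x) u(t,x)`, `ψ` a smooth bump equal to `1` on the closed ball `B̄(0, r_in)` and supported in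
`B(0, r_out)` (Mathlib `ContDiffBump (0 : ℝ³)`):

* `isSmoothSpaceTimeOn_cutoff`, `isUniformlyLipschitzOn_cutoff` — `ũ` is jointly smooth and satisfies the Cauchy–Lipschitz hypotheses
  `ODE.IsUniformlyLipschitzOn ũ S` on ANY time set of unique differentiability (its slice gradient is continuous on `C × B̄(0,r_out)`,
  compact for compact `C`, and vanishes outside) — NO hypothesis on `u` beyond joint smoothness;
* `fderiv_cutoff_of_mem_ball`, `divergence_cutoff_of_mem_ball` — on the plateau ball `B(0,r_in)` the cutoff field has the gradient of
  `u`, hence divergence `0` when `u(t)` is divergence-free (`ũ` itself is NOT divergence-free, and need not be);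
* `hasDerivAt_cutoffFlow_of_mem` — a trajectory of the cutoff flow is a `u`-trajectory while it is in `B̄(0,r_in)`;
* `det_fderiv_cutoffFlow_eq_one` — **JACOBIAN ONE ON STAY LABELS**: by Liouville's formula
  `Literature.Analysis.FluidPDE.det_fderiv_evolutionMap_eq_exp_integral_divergence_of_mem` (`det ∇X = exp ∫ div ũ(σ, X_σ)`), a label whose
  trajectory stays in `B(0,r_in)` between `t₀` and `t` has `det ∇X_t = 1`;
* `setLIntegral_comp_cutoffFlow_eq`, `volume_image_cutoffFlow_eq` — change of variables / volume preservation on measurable sets of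
  STAY labels (Mathlib `lintegral_image_eq_lintegral_abs_det_fderiv_mul`, injectivity of the global flow).

WHAT THIS IS NOT: not NS, not the crux E — kinematics of a classical flow, `--supports` stmt-19832 for ONE stub of ONE line; 19832 OPEN.
[cite: CrippaDeLellis2008, §2–3; MajdaBertozziCUP2002, §1.3 Prop. 1.4, §1.6; Hartman2002, Ch. V Cor. 3.1]
-/

noncomputable section

-- flat `Theorems/<Route><Decl>…` files of one crux share the namespace of the crux (tree convention)
set_option linter.dupNamespace false

open MeasureTheory Set Filter Topology Metric Function InnerProductSpace
open scoped RealInnerProductSpace NNReal ENNReal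

namespace Summit.NavierStokesRegularity.NavierStokesRegularity.Theorems.PowerGaugeEulerLiouville.AnchoredBudget

open Literature.Analysis Literature.Analysis.FluidPDE Literature.Analysis.ODE

variable {u : ℝ → EuclideanSpace ℝ (Fin 3) → EuclideanSpace ℝ (Fin 3)} {p : ℝ → EuclideanSpace ℝ (Fin 3) → ℝ} {S : Set ℝ}

/-! ### The cutoff field `ψ · u` -/

/-- The cutoff field `(t,x) ↦ ψ(x) u(t,x)` of a jointly smooth field is jointly smooth. [cite: MajdaBertozziCUP2002, §1.3] -/
theorem isSmoothSpaceTimeOn_cutoff (hu : IsSmoothSpaceTimeOn S u) (φ : ContDiffBump (0 : EuclideanSpace ℝ (Fin 3))) :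
    IsSmoothSpaceTimeOn S (fun t x => (φ : EuclideanSpace ℝ (Fin 3) → ℝ) x • u t x) :=
  (isSmoothSpaceTimeOn_const_time (φ.contDiff (n := ⊤)) S).smul hu

/-- On the plateau `B̄(0,r_in)` the cutoff field IS the field. [folklore] -/
theorem cutoff_apply_of_mem_closedBall (φ : ContDiffBump (0 : EuclideanSpace ℝ (Fin 3))) {x : EuclideanSpace ℝ (Fin 3)}
    (hx : x ∈ closedBall (0 : EuclideanSpace ℝ (Fin 3)) φ.rIn) (t : ℝ) :
    (φ : EuclideanSpace ℝ (Fin 3) → ℝ) x • u t x = u t x := by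
  rw [φ.one_of_mem_closedBall hx, one_smul]

/-- On the open plateau ball the cutoff slice agrees with the slice near every point. [folklore] -/
theorem cutoff_eventuallyEq_of_mem_ball (φ : ContDiffBump (0 : EuclideanSpace ℝ (Fin 3))) {x : EuclideanSpace ℝ (Fin 3)}
    (hx : x ∈ ball (0 : EuclideanSpace ℝ (Fin 3)) φ.rIn) (t : ℝ) :
    (fun y => (φ : EuclideanSpace ℝ (Fin 3) → ℝ) y • u t y) =ᶠ[𝓝 x] u t := by
  filter_upwards [φ.eventuallyEq_one_of_mem_ball hx] with y hy
  rw [hy, Pi.one_apply, one_smul]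

/-- On the open plateau ball the cutoff slice has the gradient of the slice. [folklore] -/
theorem fderiv_cutoff_of_mem_ball (φ : ContDiffBump (0 : EuclideanSpace ℝ (Fin 3))) {x : EuclideanSpace ℝ (Fin 3)}
    (hx : x ∈ ball (0 : EuclideanSpace ℝ (Fin 3)) φ.rIn) (t : ℝ) :
    fderiv ℝ (fun y => (φ : EuclideanSpace ℝ (Fin 3) → ℝ) y • u t y) x = fderiv ℝ (u t) x :=
  (cutoff_eventuallyEq_of_mem_ball φ hx t).fderiv_eq

/-- On the open plateau ball the cutoff slice is divergence-free where the slice is (outside it is NOT, and need not be).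
[cite: MajdaBertozziCUP2002, §1.3 (1.14)] -/
theorem divergence_cutoff_of_mem_ball (φ : ContDiffBump (0 : EuclideanSpace ℝ (Fin 3))) {x : EuclideanSpace ℝ (Fin 3)}
    (hx : x ∈ ball (0 : EuclideanSpace ℝ (Fin 3)) φ.rIn) {t : ℝ} (hdiv : VectorCalculus.IsDivFree (u t)) :
    VectorCalculus.divergence (fun y => (φ : EuclideanSpace ℝ (Fin 3) → ℝ) y • u t y) x = 0 := by
  unfold VectorCalculus.divergence
  rw [fderiv_cutoff_of_mem_ball φ hx t]
  exact hdiv x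

/-- Off the support ball `B̄(0,r_out)` the cutoff slice vanishes near every point, so its gradient is `0`. [folklore] -/
theorem fderiv_cutoff_of_notMem_closedBall (φ : ContDiffBump (0 : EuclideanSpace ℝ (Fin 3))) {x : EuclideanSpace ℝ (Fin 3)}
    (hx : x ∉ closedBall (0 : EuclideanSpace ℝ (Fin 3)) φ.rOut) (t : ℝ) :
    fderiv ℝ (fun y => (φ : EuclideanSpace ℝ (Fin 3) → ℝ) y • u t y) x = 0 := by
  have h : (fun y => (φ : EuclideanSpace ℝ (Fin 3) → ℝ) y • u t y) =ᶠ[𝓝 x] fun _ => (0 : EuclideanSpace ℝ (Fin 3)) := by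
    filter_upwards [isClosed_closedBall.isOpen_compl.mem_nhds hx] with y hy
    have hy2 : ¬ dist y (0 : EuclideanSpace ℝ (Fin 3)) ≤ φ.rOut := fun h => hy (mem_closedBall.2 h)
    rw [φ.zero_of_le_dist (not_le.1 hy2).le, zero_smul]
  rw [h.fderiv_eq]
  simp

/-- **The cutoff field satisfies the Cauchy–Lipschitz hypotheses** on any time set of unique differentiability: on a compact set of
times `C`, the slice gradient `∇(ψ u(t))(x)` is continuous on the compact `C × B̄(0,r_out)` and zero outside, hence bounded — NO
hypothesis on `u` beyond joint smoothness (no velocity envelope, no spatial Lipschitz clause). [cite: MajdaBertozziCUP2002, §4.2 proof of Thm. 4.3] -/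
theorem isUniformlyLipschitzOn_cutoff (hu : IsSmoothSpaceTimeOn S u) (hU : UniqueDiffOn ℝ S)
    (φ : ContDiffBump (0 : EuclideanSpace ℝ (Fin 3))) :
    ODE.IsUniformlyLipschitzOn (fun t x => (φ : EuclideanSpace ℝ (Fin 3) → ℝ) x • u t x) S := by
  have hsm := isSmoothSpaceTimeOn_cutoff hu φ
  refine hsm.isUniformlyLipschitzOn_of_norm_fderiv_le fun C hC hCS => ?_
  have hcont : ContinuousOn
      (uncurry fun t x => fderiv ℝ (fun y => (φ : EuclideanSpace ℝ (Fin 3) → ℝ) y • u t y) x) (S ×ˢ univ) :=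
    (hsm.fderiv_slice hU).continuousOn
  obtain ⟨M, hM⟩ := (hC.prod (isCompact_closedBall (0 : EuclideanSpace ℝ (Fin 3)) φ.rOut)).exists_bound_of_continuousOn
    (hcont.mono (prod_mono hCS (subset_univ _)))
  refine ⟨max M 0, fun t ht x => ?_⟩
  by_cases hx : x ∈ closedBall (0 : EuclideanSpace ℝ (Fin 3)) φ.rOut
  · exact (hM (t, x) (mk_mem_prod ht hx)).trans (le_max_left _ _)
  · rw [fderiv_cutoff_of_notMem_closedBall φ hx t, norm_zero]; exact le_max_right _ _

/-! ### The cutoff flow `X = φ(·, t₀, ·)` of `ψ · u` -/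

/-- The cutoff flow is jointly continuous in `(t, ξ)` on `S × ℝ³`. [cite: Hartman2002, Ch. V Cor. 4.1] -/
theorem continuousOn_cutoffFlow (hu : IsSmoothSpaceTimeOn S u) (hS : Convex ℝ S) (hU : UniqueDiffOn ℝ S)
    (φ : ContDiffBump (0 : EuclideanSpace ℝ (Fin 3))) {t₀ : ℝ} (ht₀ : t₀ ∈ S) :
    ContinuousOn (fun q : ℝ × EuclideanSpace ℝ (Fin 3) =>
      ODE.evolutionMap (fun t x => (φ : EuclideanSpace ℝ (Fin 3) → ℝ) x • u t x) t₀ q.1 q.2) (S ×ˢ univ) :=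
  ((isUniformlyLipschitzOn_cutoff hu hU φ).contDiffOn_evolutionMap_uncurry hS hU (n := 1) le_rfl
    ((isSmoothSpaceTimeOn_cutoff hu φ).of_le (by exact_mod_cast le_top)) ht₀).continuousOn

/-- The cutoff flow solves `Ẋ = ψ(X) u(t,X)` (two-sided derivative at interior times). [cite: Teschl2012, eq. (2.42)] -/
theorem hasDerivAt_cutoffFlow (hu : IsSmoothSpaceTimeOn S u) (hS : Convex ℝ S) (hU : UniqueDiffOn ℝ S)
    (φ : ContDiffBump (0 : EuclideanSpace ℝ (Fin 3))) {t₀ t : ℝ} (ht₀ : t₀ ∈ S) (ht : S ∈ 𝓝 t) (ξ : EuclideanSpace ℝ (Fin 3)) :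
    HasDerivAt (fun s => ODE.evolutionMap (fun t x => (φ : EuclideanSpace ℝ (Fin 3) → ℝ) x • u t x) t₀ s ξ)
      ((φ : EuclideanSpace ℝ (Fin 3) → ℝ) (ODE.evolutionMap (fun t x => (φ : EuclideanSpace ℝ (Fin 3) → ℝ) x • u t x) t₀ t ξ) •
        u t (ODE.evolutionMap (fun t x => (φ : EuclideanSpace ℝ (Fin 3) → ℝ) x • u t x) t₀ t ξ)) t :=
  (isUniformlyLipschitzOn_cutoff hu hU φ).hasDerivAt_evolutionMap hS ht₀ ht ξ

/-- **Inside the plateau the cutoff flow is the particle flow**: at a time when the trajectory sits in `B̄(0,r_in)` its velocity is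
`u(t, X_t ξ)`. [cite: MajdaBertozziCUP2002, §1.3 (1.13)] -/
theorem hasDerivAt_cutoffFlow_of_mem (hu : IsSmoothSpaceTimeOn S u) (hS : Convex ℝ S) (hU : UniqueDiffOn ℝ S)
    (φ : ContDiffBump (0 : EuclideanSpace ℝ (Fin 3))) {t₀ t : ℝ} (ht₀ : t₀ ∈ S) (ht : S ∈ 𝓝 t) {ξ : EuclideanSpace ℝ (Fin 3)}
    (hin : ODE.evolutionMap (fun t x => (φ : EuclideanSpace ℝ (Fin 3) → ℝ) x • u t x) t₀ t ξ ∈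
      closedBall (0 : EuclideanSpace ℝ (Fin 3)) φ.rIn) :
    HasDerivAt (fun s => ODE.evolutionMap (fun t x => (φ : EuclideanSpace ℝ (Fin 3) → ℝ) x • u t x) t₀ s ξ)
      (u t (ODE.evolutionMap (fun t x => (φ : EuclideanSpace ℝ (Fin 3) → ℝ) x • u t x) t₀ t ξ)) t := by
  have h := hasDerivAt_cutoffFlow hu hS hU φ ht₀ ht ξ
  rwa [φ.one_of_mem_closedBall hin, one_smul] at h

/-- **JACOBIAN ONE ON STAY LABELS** (Liouville's formula for the cutoff flow): for a classical Euler flow `u` on `S` (so `div u(σ) = 0`)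
and a label `ξ` whose cutoff-flow trajectory stays in the plateau ball `B(0,r_in)` between `t₀` and `t`, `det ∇X_t(ξ) = 1` — there the
divergence of the cutoff field along the trajectory is `div u = 0`. [cite: Hartman2002, Ch. V Cor. 3.1 eq. (3.5); MajdaBertozziCUP2002, §1.3 Prop. 1.4] -/
theorem det_fderiv_cutoffFlow_eq_one (hcl : IsClassicalEulerSolutionOn S 0 u p) (hS : Convex ℝ S) (hU : UniqueDiffOn ℝ S)
    (φ : ContDiffBump (0 : EuclideanSpace ℝ (Fin 3))) {t₀ t : ℝ} (ht₀ : t₀ ∈ S) (ht : t ∈ S) {ξ : EuclideanSpace ℝ (Fin 3)}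
    (hstay : ∀ σ ∈ uIcc t₀ t, ODE.evolutionMap (fun t x => (φ : EuclideanSpace ℝ (Fin 3) → ℝ) x • u t x) t₀ σ ξ ∈
      ball (0 : EuclideanSpace ℝ (Fin 3)) φ.rIn) :
    (fderiv ℝ (ODE.evolutionMap (fun t x => (φ : EuclideanSpace ℝ (Fin 3) → ℝ) x • u t x) t₀ t) ξ).det = 1 := by
  rw [det_fderiv_evolutionMap_eq_exp_integral_divergence_of_mem (isUniformlyLipschitzOn_cutoff hcl.smooth_velocity hU φ)
    (isSmoothSpaceTimeOn_cutoff hcl.smooth_velocity φ) hS hU ht₀ ht ξ]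
  have hsub := hS.ordConnected.uIcc_subset ht₀ ht
  have h0 : ∀ σ ∈ uIcc t₀ t, VectorCalculus.divergence (fun x => (φ : EuclideanSpace ℝ (Fin 3) → ℝ) x • u σ x)
      (ODE.evolutionMap (fun t x => (φ : EuclideanSpace ℝ (Fin 3) → ℝ) x • u t x) t₀ σ ξ) = 0 :=
    fun σ hσ => divergence_cutoff_of_mem_ball φ (hstay σ hσ) (hcl.divFree σ (hsub hσ))
  rw [intervalIntegral.integral_congr (g := fun _ => (0 : ℝ)) h0]
  simp

/-- The cutoff flow maps measurable sets to measurable sets. [folklore] -/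
theorem measurableSet_image_cutoffFlow (hu : IsSmoothSpaceTimeOn S u) (hS : Convex ℝ S) (hU : UniqueDiffOn ℝ S)
    (φ : ContDiffBump (0 : EuclideanSpace ℝ (Fin 3))) {t₀ t : ℝ} (ht₀ : t₀ ∈ S) (ht : t ∈ S) {A : Set (EuclideanSpace ℝ (Fin 3))}
    (hAm : MeasurableSet A) :
    MeasurableSet (ODE.evolutionMap (fun t x => (φ : EuclideanSpace ℝ (Fin 3) → ℝ) x • u t x) t₀ t '' A) :=
  (isUniformlyLipschitzOn_cutoff hu hU φ).measurableSet_image_evolutionMap hS ht₀ ht hAm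

/-- **Change of variables on STAY labels**: `∫⁻_{ξ ∈ A} g(X_t ξ) dξ = ∫⁻_{X_t A} g` for a measurable set `A` of labels whose trajectories stay in
the plateau ball between `t₀` and `t` (Jacobian one there, injectivity of the global cutoff flow). [cite: MajdaBertozziCUP2002, §1.3 Prop. 1.4] -/
theorem setLIntegral_comp_cutoffFlow_eq (hcl : IsClassicalEulerSolutionOn S 0 u p) (hS : Convex ℝ S) (hU : UniqueDiffOn ℝ S)
    (φ : ContDiffBump (0 : EuclideanSpace ℝ (Fin 3))) {t₀ t : ℝ} (ht₀ : t₀ ∈ S) (ht : t ∈ S) {A : Set (EuclideanSpace ℝ (Fin 3))}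
    (hAm : MeasurableSet A)
    (hstay : ∀ ξ ∈ A, ∀ σ ∈ uIcc t₀ t, ODE.evolutionMap (fun t x => (φ : EuclideanSpace ℝ (Fin 3) → ℝ) x • u t x) t₀ σ ξ ∈
      ball (0 : EuclideanSpace ℝ (Fin 3)) φ.rIn)
    (g : EuclideanSpace ℝ (Fin 3) → ℝ≥0∞) :
    ∫⁻ ξ in A, g (ODE.evolutionMap (fun t x => (φ : EuclideanSpace ℝ (Fin 3) → ℝ) x • u t x) t₀ t ξ) =
      ∫⁻ y in ODE.evolutionMap (fun t x => (φ : EuclideanSpace ℝ (Fin 3) → ℝ) x • u t x) t₀ t '' A, g y := by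
  have hL := isUniformlyLipschitzOn_cutoff hcl.smooth_velocity hU φ
  have hsm := isSmoothSpaceTimeOn_cutoff hcl.smooth_velocity φ
  set X := ODE.evolutionMap (fun t x => (φ : EuclideanSpace ℝ (Fin 3) → ℝ) x • u t x) t₀ t with hX
  have hdiff : ∀ x ∈ A, HasFDerivWithinAt X (fderiv ℝ X x) A x := fun x _ =>
    (((hL.contDiff_evolutionMap hS hU le_top hsm ht₀ ht).differentiable (by simp)) x).hasFDerivAt.hasFDerivWithinAt
  have hinj : InjOn X A := (hL.bijective_evolutionMap hS ht₀ ht).injective.injOn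
  rw [lintegral_image_eq_lintegral_abs_det_fderiv_mul volume hAm hdiff hinj]
  refine setLIntegral_congr_fun hAm fun x hx => ?_
  rw [hX, det_fderiv_cutoffFlow_eq_one hcl hS hU φ ht₀ ht (hstay x hx)]
  simp

/-- **Volume preservation on STAY labels**: `|X_t A| = |A|` for a measurable set `A` of labels whose trajectories stay in the plateau ball
between `t₀` and `t`. [cite: MajdaBertozziCUP2002, §1.3 Prop. 1.4] -/
theorem volume_image_cutoffFlow_eq (hcl : IsClassicalEulerSolutionOn S 0 u p) (hS : Convex ℝ S) (hU : UniqueDiffOn ℝ S)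
    (φ : ContDiffBump (0 : EuclideanSpace ℝ (Fin 3))) {t₀ t : ℝ} (ht₀ : t₀ ∈ S) (ht : t ∈ S) {A : Set (EuclideanSpace ℝ (Fin 3))}
    (hAm : MeasurableSet A)
    (hstay : ∀ ξ ∈ A, ∀ σ ∈ uIcc t₀ t, ODE.evolutionMap (fun t x => (φ : EuclideanSpace ℝ (Fin 3) → ℝ) x • u t x) t₀ σ ξ ∈
      ball (0 : EuclideanSpace ℝ (Fin 3)) φ.rIn) :
    volume (ODE.evolutionMap (fun t x => (φ : EuclideanSpace ℝ (Fin 3) → ℝ) x • u t x) t₀ t '' A) = volume A := by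
  have h := setLIntegral_comp_cutoffFlow_eq hcl hS hU φ ht₀ ht hAm hstay (fun _ => 1)
  rw [setLIntegral_one, setLIntegral_one] at h
  exact h.symm

end Summit.NavierStokesRegularity.NavierStokesRegularity.Theorems.PowerGaugeEulerLiouville.AnchoredBudget

end
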